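import Summits.Langlands.Langlands.Theses.NonParallelVoid
import Summits.Langlands.Langlands.Theorems.NonParallelVoidGapArithmetic
import Literature.NumberTheory.GaloisRepresentations.CalegariEvenFontaineMazurTwo

/-!
# `TensorSquareParallel` (stmt-Langlands-17009) — Negative knowledge I: void normal form and the
# abstract-character typings

From the standing disprover's `Cruxes/TensorSquareParallel/Disproof.lean` (cdisprove cycle 1, 2026-08-17, §1 and
§3; the named hypothesis blocks `RegularShape`/`GoodRegime`/`ParityClause`/`BaseChangeType` live there).  The crux
is NOT refuted; this file certifies what every prover and every later refuter may take for granted: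

* `tensorSquareParallel_iff_void` — the negated parity clause (two labels with ODD gap sum) makes the conclusion
  `∃ g, ∀ label, HT = {a, a + g}` contradictory (tree lemma `even_gapSum_of_common_gap`), so the crux IS the
  emptiness of its hypothesis set: the right-hand side is the crux VERBATIM with its conclusion replaced by
  `False`.  A proof derives `False` from the hypotheses and ends with `.2`; a refutation exhibits ONE `ρ` meeting
  them for THE pinned Fontaine datum (first observed by the vetting seat `refuter-rattack-stmt-Langlands-17009-0`,
  evidence `Readback.lean`; certified here in the tree).
* `dihedralChar_ker_le`, `baseChangeChar_eq_one_of_mem_ker`, `two_ne_zero_padicAlgClResidueField` — the two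
  "abstract character" typings of the route (`χ : Γ_F →* k̄ˣ` in the base-change clause, `η : Γ_{F(ζ_p)} →* k̄ˣ`
  in the dihedral predicate of lines `birth`/`merged`, both WITHOUT continuity) are not loopholes: wherever `ρ̄`
  is trivial its trace is `2 ≠ 0` (`p ≠ 2`), so such a character is trivial on `ker ρ̄` and factors through the
  finite image — `¬`(base-change type) as typed coincides with its continuous reading, and `η` may be pushed to
  `im ρ̄` at once (first step of `stub_dihedralType_of_trace`).

No definitions.  Mathlib + the route file + `NonParallelVoidGapArithmetic` + `charP_padicAlgClResidueField`.
[folklore]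
-/

noncomputable section

set_option linter.dupNamespace false

open scoped NumberField
open IsDedekindDomain Field
open Literature.NumberTheory.GaloisRepresentations Literature.NumberTheory.PAdicHodge
open Summit.Langlands.Langlands.Theses.NonParallelVoid
open Summit.Langlands.Langlands.Theorems.NonParallelVoid

namespace Summit.Langlands.Langlands.Theorems.TensorSquareParallel.Negative

/-! ### Void normal form -/

/-- **`TensorSquareParallel` is exactly the emptiness of its hypothesis set**: the right-hand side is the crux
verbatim with the conclusion `∃ g, ∀ (v, τ), ∃ a, HT = {a, a + g}` replaced by `False`.  (`→`: the negated parity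
clause yields two labels with odd gap sum, and a common `g` would make that sum even,
`even_gapSum_of_common_gap`; `←`: ex falso.) [folklore] -/
theorem tensorSquareParallel_iff_void :
    TensorSquareParallel ↔
      (∀ (F : Type) [Field F] [NumberField F] [Algebra.IsQuadraticExtension ℚ F], NumberField.IsTotallyComplex F → ∀ (p : ℕ) [Fact p.Prime] (ρ : Literature.NumberTheory.GaloisRepresentations.FramedGaloisRep F (PadicAlgCl p) 2), ρ.toGaloisRep.IsIrreducible → (∀ᶠ v : IsDedekindDomain.HeightOneSpectrum (NumberField.RingOfIntegers F) in Filter.cofinite, ρ.IsUnramifiedAt v) → (∀ (v : IsDedekindDomain.HeightOneSpectrum (NumberField.RingOfIntegers F)) (hv : ((p : ℕ) : NumberField.RingOfIntegers F) ∈ v.asIdeal), (Literature.NumberTheory.PAdicHodge.fontainePstAdicCompletion v p hv).IsDeRhamFramed (ρ.toLocal v) ∧ (letI := (Literature.NumberTheory.PAdicHodge.fontainePstAdicCompletion v p hv).algebra; ∀ τ : v.adicCompletion F →ₐ[ℚ_[p]] PadicAlgCl p, ∃ a b : ℤ, a < b ∧ ρ.labelledHodgeTateWeightsAt v (Literature.NumberTheory.PAdicHodge.fontainePstAdicCompletion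 v p hv).algebra (Literature.NumberTheory.PAdicHodge.fontainePstAdicCompletion v p hv).𝔅 τ.toRingHom = {a, b})) → (11 ≤ p ∧ (∃ v w : IsDedekindDomain.HeightOneSpectrum (NumberField.RingOfIntegers F), v ≠ w ∧ ((p : ℕ) : NumberField.RingOfIntegers F) ∈ v.asIdeal ∧ ((p : ℕ) : NumberField.RingOfIntegers F) ∈ w.asIdeal) ∧ (∀ (v : IsDedekindDomain.HeightOneSpectrum (NumberField.RingOfIntegers F)) (hv : ((p : ℕ) : NumberField.RingOfIntegers F) ∈ v.asIdeal), (Literature.NumberTheory.PAdicHodge.fontainePstAdicCompletion v p hv).IsCrystallineFramed (ρ.toLocal v)) ∧ Literature.NumberTheory.GaloisRepresentations.FramedGaloisRep.IsResiduallyAbsIrreducible (ρ.restrictField (CyclotomicField p F))) → ¬ (∀ (v : IsDedekindDomain.HeightOneSpectrum (NumberField.RingOfIntegers F)) (hv : ((p : ℕ) : NumberField.RingOfIntegers F) ∈ v.asIdeal) (w : IsDedekindDomain.HeightOneSpectrum (NumberField.RingOfIntegers F)) (hw : ((p : ℕ) : NumberField.RingOfIntegers F) ∈ w.asIdeal), letI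 := (Literature.NumberTheory.PAdicHodge.fontainePstAdicCompletion v p hv).algebra; letI := (Literature.NumberTheory.PAdicHodge.fontainePstAdicCompletion w p hw).algebra; ∀ (τ : v.adicCompletion F →ₐ[ℚ_[p]] PadicAlgCl p) (σ : w.adicCompletion F →ₐ[ℚ_[p]] PadicAlgCl p) (a b a' b' : ℤ), ρ.labelledHodgeTateWeightsAt v (Literature.NumberTheory.PAdicHodge.fontainePstAdicCompletion v p hv).algebra (Literature.NumberTheory.PAdicHodge.fontainePstAdicCompletion v p hv).𝔅 τ.toRingHom = {a, b} → a < b → ρ.labelledHodgeTateWeightsAt w (Literature.NumberTheory.PAdicHodge.fontainePstAdicCompletion w p hw).algebra (Literature.NumberTheory.PAdicHodge.fontainePstAdicCompletion w p hw).𝔅 σ.toRingHom = {a', b'} → a' < b' → Even (b - a + (b' - a'))) → ¬ (∃ τ : Field.absoluteGaloisGroup ℚ, τ ∉ Set.range (Literature.NumberTheory.GaloisRepresentations.absGaloisRestrict ℚ F) ∧ ∃ χ : Field.absoluteGaloisGroup F →* (Literature.NumberTheory.GaloisRepresentations.padicAlgClResidueField p)ˣ, ∀ σ σ' : Field.absoluteGaloisGroup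 F, Literature.NumberTheory.GaloisRepresentations.absGaloisRestrict ℚ F σ' = τ * Literature.NumberTheory.GaloisRepresentations.absGaloisRestrict ℚ F σ * τ⁻¹ → (ρ.residualRep σ').val.trace = (χ σ : Literature.NumberTheory.GaloisRepresentations.padicAlgClResidueField p) * (ρ.residualRep σ).val.trace ∧ (ρ.residualRep σ').val.det = (χ σ : Literature.NumberTheory.GaloisRepresentations.padicAlgClResidueField p) ^ 2 * (ρ.residualRep σ).val.det) → False) := by
  unfold TensorSquareParallel
  refine ⟨fun h F _ _ _ hF p _ ρ hirr hunr hHT hG hE hB => ?_, fun h F _ _ _ hF p _ ρ hirr hunr hHT hG hE hB => ?_⟩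
  · obtain ⟨g, hg⟩ := h F hF p ρ hirr hunr hHT hG hE hB
    apply hE
    intro v hv w hw τ σ a b a' b' h1 _ h3 _
    obtain ⟨x, hx⟩ := hg v hv τ
    obtain ⟨x', hx'⟩ := hg w hw σ
    exact even_gapSum_of_common_gap (hx.symm.trans h1) (hx'.symm.trans h3)
  · exact (h F hF p ρ hirr hunr hHT hG hE hB).elim

/-! ### The abstract characters of the trace identities are trivial on `ker ρ̄` -/

section AbstractCharacters

variable {G k : Type*} [Group G] [Field k]

/-- Core computation: if `tr B = c · tr A` with `A = B = 1` in `GL₂(k)` and `2 ≠ 0` in `k`, then `c = 1`. [folklore] -/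
theorem twistUnit_eq_one_of_trace (h2 : (2 : k) ≠ 0) {A B : GL (Fin 2) k} (hA : A = 1) (hB : B = 1) {c : kˣ}
    (h : (B : Matrix (Fin 2) (Fin 2) k).trace = (c : k) * (A : Matrix (Fin 2) (Fin 2) k).trace) : c = 1 := by
  subst hA; subst hB
  have htr : ((1 : GL (Fin 2) k) : Matrix (Fin 2) (Fin 2) k).trace = 2 := by
    rw [Units.val_one, Matrix.trace_one, Fintype.card_fin]; norm_num
  rw [htr] at h
  have hc : (c : k) = 1 := by
    have : (2 : k) * ((c : k) - 1) = 0 := by linear_combination -h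
    rcases mul_eq_zero.1 this with h0 | h0
    · exact absurd h0 h2
    · linear_combination h0
  exact Units.val_eq_one.1 hc

/-- **Dihedral predicate** (`∃ η ≠ 1, ∀ σ, tr r(σ) = η(σ) tr r(σ)`, lines `birth`/`merged`): any such ABSTRACT
`η : G →* kˣ` is trivial on `ker r` when `2 ≠ 0` in `k`, hence factors through the (finite) image of `r`; the
omitted continuity is automatic. [folklore] -/
theorem dihedralChar_ker_le (h2 : (2 : k) ≠ 0) (r : G →* GL (Fin 2) k) (η : G →* kˣ)
    (hη : ∀ σ, ((r σ : GL (Fin 2) k) : Matrix (Fin 2) (Fin 2) k).trace =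
      (η σ : k) * ((r σ : GL (Fin 2) k) : Matrix (Fin 2) (Fin 2) k).trace) :
    r.ker ≤ η.ker := by
  intro σ hσ
  rw [MonoidHom.mem_ker] at hσ ⊢
  exact twistUnit_eq_one_of_trace h2 hσ hσ (hη σ)

/-- **Base-change clause** (`tr r(σ') = χ(σ) tr r(σ)` whenever `σ'` is the `θ_τ`-image of `σ`): any such
ABSTRACT `χ` is trivial at every `σ` with `r σ = 1` and `r σ' = 1` — for `r = ρ̄` an open subgroup
(`ker ρ̄ ∩ θ_τ⁻¹ ker ρ̄`), so `χ` is continuous and the negated base-change clause as typed is its continuous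
reading. [folklore] -/
theorem baseChangeChar_eq_one_of_mem_ker (h2 : (2 : k) ≠ 0) (r : G →* GL (Fin 2) k) (χ : G →* kˣ)
    {σ σ' : G} (hσ : r σ = 1) (hσ' : r σ' = 1)
    (h : ((r σ' : GL (Fin 2) k) : Matrix (Fin 2) (Fin 2) k).trace =
      (χ σ : k) * ((r σ : GL (Fin 2) k) : Matrix (Fin 2) (Fin 2) k).trace) : χ σ = 1 :=
  twistUnit_eq_one_of_trace h2 hσ hσ' h

/-- In the crux `k = ℤ̄_p/𝔪` with `11 ≤ p`, so `2 ≠ 0` there (tree: `charP_padicAlgClResidueField`). [folklore] -/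
theorem two_ne_zero_padicAlgClResidueField (p : ℕ) [Fact p.Prime] (hp : p ≠ 2) :
    (2 : padicAlgClResidueField p) ≠ 0 := by
  haveI := charP_padicAlgClResidueField p
  intro h
  have h' : ((2 : ℕ) : padicAlgClResidueField p) = 0 := by exact_mod_cast h
  rw [CharP.cast_eq_zero_iff (padicAlgClResidueField p) p] at h'
  have hp2 : p ≤ 2 := Nat.le_of_dvd (by norm_num) h'
  have := (Fact.out : p.Prime).two_le
  omega

end AbstractCharacters

end Summit.Langlands.Langlands.Theorems.TensorSquareParallel.Negative

end
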